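import Summits.Ventures.PercRepro.ThetaOmegaCoreBadTwoPos

/-!
# A bad edge of type T00 and a bad two-edge point in general position

Dossier proofs/MINE1-theoremS.md, Addendum 81 suppl. 2 (mine-1, gen 42). With the positions of
`ThetaOmegaCoreBadTwoPos.lean`, a bad edge `(s, s + q)` of type T00 and a bad two-edge point `r`
with edges `(b, b + r)`, `(a, a + r)` (`b` K-mono of colour `δ`, `c1 a = ¬δ`, `a` K-mono or `∅`)
in general position cannot coexist: `r ∉ s` forces both edges of `r` below `s` and the co-join
mechanism at `q` fires; `r ∈ s` leaves four configurations in which the meet–meet,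
difference–difference, meet–difference or difference–meet mechanism at `q` fires
(**`t00_badTwo_nondeg_false`**).
-/

namespace PercRepro.MSTight

open Finset

variable {α : Type*} [DecidableEq α]

section Main

variable {q r : α} {U : Finset α} {F : Finset (Finset α)} {c0 c1 : Finset α → Bool}
  {s a b : Finset α}

/-- **A T00 bad edge and a bad two-edge point in general position cannot coexist.** -/
theorem t00_badTwo_nondeg_false (hq : BadEdge U F c0 c1 q s) (hqr : q ≠ r)
    (hs0 : c0 s = c1 s) (hu0 : c0 (insert q s) = c1 (insert q s))
    (hrU : r ∈ U) (hrA : ∀ d ∈ qEdges r (omegaA F c0 c1), d = ∅)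
    (hrC : ∀ d, d ∉ qEdges r (omegaC U F c1))
    (hb : b ∈ F) (hrb : r ∉ b) (hvb : insert r b ∈ F) (hKb : c0 (insert r b) = c1 b)
    (ha : a ∈ F) (hra : r ∉ a) (hva : insert r a ∈ F) (hKa : c0 (insert r a) = c1 a ∨ a = ∅)
    (hopp : c1 a ≠ c1 b) (hndb : NonDeg q s r b) (hnda : NonDeg q s r a) : False := by
  have hsF := hq.2.1
  have hqs := hq.2.2.1
  have huF := hq.2.2.2.1
  have hexc := hq.2.2.2.2.1
  -- the colours of the T00 edge: `c0 u = c1 u ≠ c0 s = c1 s`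
  have h0 : c0 s ≠ c0 (insert q s) := fun h => hexc (h.symm.trans hs0)
  have h1 : c1 s ≠ c1 (insert q s) := fun h => hexc (hu0.trans h.symm)
  have hqvb : q ∉ b → q ∉ insert r b := fun hqb h => by
    rcases mem_insert.1 h with h' | h'
    · exact hqr h'
    · exact hqb h'
  have hqva : q ∉ a → q ∉ insert r a := fun hqa h => by
    rcases mem_insert.1 h with h' | h'
    · exact hqr h'
    · exact hqa h'
  have hmemF : ∀ z, (z = insert r b ∨ z = insert r a) → z ∈ F := by
    rintro z (rfl | rfl)
    · exact hvb
    · exact hva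
  have hmemF' : ∀ z, (z = b ∨ z = a) → z ∈ F := by
    rintro z (rfl | rfl)
    · exact hb
    · exact ha
  have hne_s : ∀ z, (z = insert r b ∨ z = insert r a) → z ≠ s := by
    rintro z (rfl | rfl)
    · exact hndb.2.2.1
    · exact hnda.2.2.1
  have hne_u : ∀ z, (z = insert r b ∨ z = insert r a) → z ≠ insert q s := by
    rintro z (rfl | rfl)
    · exact hndb.2.2.2
    · exact hnda.2.2.2
  have hne_s' : ∀ z, (z = b ∨ z = a) → z ≠ s := by
    rintro z (rfl | rfl)
    · exact hndb.1
    · exact hnda.1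
  have hne_u' : ∀ z, (z = b ∨ z = a) → z ≠ insert q s := by
    rintro z (rfl | rfl)
    · exact hndb.2.1
    · exact hnda.2.1
  by_cases hrs : r ∈ s
  · by_cases hqb : q ∈ b <;> by_cases hqa : q ∈ a
    · -- `q ∈ b`, `q ∈ a`: `s ⊆ b + r`, `s ⊆ a + r`; the meet–meet mechanism at `q`
      have hane : a ≠ ∅ := fun h => by rw [h] at hqa; exact notMem_empty q hqa
      have hKa' : c0 (insert r a) = c1 a := hKa.resolve_right hane
      have hsb := badTwo_subset_insert hq h0 hrA hb hrb hvb hqb hrs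
      have hsa := badTwo_subset_insert hq h0 hrA ha hra hva hqa hrs
      have hcb : c0 b = c1 b := (edge_c0_eq_of_mem hq hb hvb hndb hqb).trans hKb
      have hca : c0 a = c1 a := (edge_c0_eq_of_mem hq ha hva hnda hqa).trans hKa'
      have hne : c0 b ≠ c0 a := fun h => hopp ((hca.symm.trans h.symm).trans hcb)
      have hmemq : ∀ z, (z = b ∨ z = a) → q ∈ z := by
        rintro z (rfl | rfl)
        · exact hqb
        · exact hqa
      have heq : ∀ z, (z = b ∨ z = a) → s ⊓ z = s.erase r := by
        rintro z (rfl | rfl)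
        · exact inf_insert_eq_erase_of_subset hrb hsb
        · exact inf_insert_eq_erase_of_subset hra hsa
      obtain ⟨y, hy, hyc⟩ := exists_of_ne c0 hne (c0 s)
      obtain ⟨x, hx, hxc⟩ := exists_of_ne c0 hne (c0 (insert q s))
      exact badEdge_not_mem_qEdges hq (qEdge_of_inf_inf hsF hqs huF (hmemF' y hy) (hne_s' y hy)
        hyc (hmemF' x hx) (hne_u' x hx) hxc (hmemq x hx) ((heq y hy).trans (heq x hx).symm))
    · -- `q ∈ b`, `q ∉ a`: `s ⊆ b + r`, `a ⊓ s = ∅`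
      have hsb := badTwo_subset_insert hq h0 hrA hb hrb hvb hqb hrs
      have hda := badTwo_inter_empty hq h0 hrA ha hra hva hnda hqa hrs
      have hcb : c0 b = c1 b := (edge_c0_eq_of_mem hq hb hvb hndb hqb).trans hKb
      have hca : c1 (insert r a) = c1 a := (edge_c1_eq_of_notMem hq hqr ha hva hnda hqa).symm
      have hne : c1 (insert r a) ≠ c0 b := fun h => hopp ((hca.symm.trans h).trans hcb)
      have heqb : s ⊓ b = s.erase r := inf_insert_eq_erase_of_subset hrb hsb
      have heqa : s \ insert r a = s.erase r := sdiff_insert_eq_erase_of_disjoint hda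
      by_cases hbs : c0 b = c0 s
      · have hne' : c1 (insert r a) ≠ c0 s := by rwa [hbs] at hne
        have hx : c0 (insert q s) = c1 (insert r a) := bool_eq_of_ne_of_ne (Ne.symm h0) hne'
        exact badEdge_not_mem_qEdges hq (qEdge_of_inf_sdiff hsF hqs huF hb hndb.1 hbs hva hx
          (hqva hqa) (heqb.trans heqa.symm))
      · have hbu : c0 b = c0 (insert q s) := bool_eq_of_ne_of_ne hbs (Ne.symm h0)
        have hne' : c1 (insert r a) ≠ c0 (insert q s) := by rwa [hbu] at hne
        have hy : c0 s = c1 (insert r a) := bool_eq_of_ne_of_ne h0 hne'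
        exact badEdge_not_mem_qEdges hq (qEdge_of_sdiff_inf hsF hqs huF hva hy hb hndb.2.1 hbu
          hqb (heqa.trans heqb.symm))
    · -- `q ∉ b`, `q ∈ a`: `b ⊓ s = ∅`, `s ⊆ a + r`
      have hane : a ≠ ∅ := fun h => by rw [h] at hqa; exact notMem_empty q hqa
      have hKa' : c0 (insert r a) = c1 a := hKa.resolve_right hane
      have hdb := badTwo_inter_empty hq h0 hrA hb hrb hvb hndb hqb hrs
      have hsa := badTwo_subset_insert hq h0 hrA ha hra hva hqa hrs
      have hca : c0 a = c1 a := (edge_c0_eq_of_mem hq ha hva hnda hqa).trans hKa'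
      have hcb : c1 (insert r b) = c1 b := (edge_c1_eq_of_notMem hq hqr hb hvb hndb hqb).symm
      have hne : c1 (insert r b) ≠ c0 a := fun h => hopp ((hca.symm.trans h.symm).trans hcb)
      have heqa : s ⊓ a = s.erase r := inf_insert_eq_erase_of_subset hra hsa
      have heqb : s \ insert r b = s.erase r := sdiff_insert_eq_erase_of_disjoint hdb
      by_cases has : c0 a = c0 s
      · have hne' : c1 (insert r b) ≠ c0 s := by rwa [has] at hne
        have hx : c0 (insert q s) = c1 (insert r b) := bool_eq_of_ne_of_ne (Ne.symm h0) hne'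
        exact badEdge_not_mem_qEdges hq (qEdge_of_inf_sdiff hsF hqs huF ha hnda.1 has hvb hx
          (hqvb hqb) (heqa.trans heqb.symm))
      · have hau : c0 a = c0 (insert q s) := bool_eq_of_ne_of_ne has (Ne.symm h0)
        have hne' : c1 (insert r b) ≠ c0 (insert q s) := by rwa [hau] at hne
        have hy : c0 s = c1 (insert r b) := bool_eq_of_ne_of_ne h0 hne'
        exact badEdge_not_mem_qEdges hq (qEdge_of_sdiff_inf hsF hqs huF hvb hy ha hnda.2.1 hau
          hqa (heqb.trans heqa.symm))
    · -- `q ∉ b`, `q ∉ a`: both disjoint from `s`; the difference–difference mechanism at `q`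
      have hdb := badTwo_inter_empty hq h0 hrA hb hrb hvb hndb hqb hrs
      have hda := badTwo_inter_empty hq h0 hrA ha hra hva hnda hqa hrs
      have hcb : c1 (insert r b) = c1 b := (edge_c1_eq_of_notMem hq hqr hb hvb hndb hqb).symm
      have hca : c1 (insert r a) = c1 a := (edge_c1_eq_of_notMem hq hqr ha hva hnda hqa).symm
      have hne : c1 (insert r b) ≠ c1 (insert r a) := fun h => hopp ((hca.symm.trans h.symm).trans hcb)
      have hmemq : ∀ z, (z = insert r b ∨ z = insert r a) → q ∉ z := by
        rintro z (rfl | rfl)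
        · exact hqvb hqb
        · exact hqva hqa
      have heq : ∀ z, (z = insert r b ∨ z = insert r a) → s \ z = s.erase r := by
        rintro z (rfl | rfl)
        · exact sdiff_insert_eq_erase_of_disjoint hdb
        · exact sdiff_insert_eq_erase_of_disjoint hda
      obtain ⟨y, hy, hyc⟩ := exists_of_ne c1 hne (c0 s)
      obtain ⟨x, hx, hxc⟩ := exists_of_ne c1 hne (c0 (insert q s))
      exact badEdge_not_mem_qEdges hq (qEdge_of_sdiff_sdiff hsF hqs huF (hmemF y hy) hyc.symm
        (hmemF x hx) hxc.symm (hmemq x hx) ((heq y hy).trans (heq x hx).symm))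
  · -- `r ∉ s`: both edges of `r` avoid `q` and lie below `s`; the co-join mechanism at `q`
    have hqb : q ∉ b := fun h => badTwo_not_mem_of_notMem hq h1 hqr hrU hrC hb hrb hvb hndb h hrs
    have hqa : q ∉ a := fun h => badTwo_not_mem_of_notMem hq h1 hqr hrU hrC ha hra hva hnda h hrs
    have hsb := badTwo_subset hq h1 hqr hrA hb hrb hvb hqb hrs
    have hsa := badTwo_subset hq h1 hqr hrA ha hra hva hqa hrs
    have hcb : c1 (insert r b) = c1 b := (edge_c1_eq_of_notMem hq hqr hb hvb hndb hqb).symm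
    have hca : c1 (insert r a) = c1 a := (edge_c1_eq_of_notMem hq hqr ha hva hnda hqa).symm
    have hne : c1 (insert r b) ≠ c1 (insert r a) := fun h => hopp ((hca.symm.trans h.symm).trans hcb)
    have hmemq : ∀ z, (z = insert r b ∨ z = insert r a) → q ∉ z := by
      rintro z (rfl | rfl)
      · exact hqvb hqb
      · exact hqva hqa
    have heq : ∀ z, (z = insert r b ∨ z = insert r a) → s ⊔ z = insert r s := by
      rintro z (rfl | rfl)
      · exact sup_insert_eq_insert_of_subset hsb
      · exact sup_insert_eq_insert_of_subset hsa
    obtain ⟨y, hy, hyc⟩ := exists_of_ne c1 hne (c1 s)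
    obtain ⟨x, hx, hxc⟩ := exists_of_ne c1 hne (c1 (insert q s))
    exact badEdge_not_mem_qEdges_omegaC hq (qEdge_of_cojoin hq.1 hsF hqs huF (hmemF y hy)
      (hne_s y hy) hyc (hmemF x hx) (hne_u x hx) hxc (hmemq x hx)
      ((heq y hy).trans (heq x hx).symm))

end Main

end PercRepro.MSTight
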